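import Summits.HodgeConjecture.HodgeConjecture.Theorems.LimitExtensionHypersurfaceHodgeFourLowDegreeProof
import Literature.AlgebraicGeometry.HodgeTheory.QuarticQuinticFourfoldHodgeClassesAlgebraic
import HarnessLib

/-!
# Route `LimitExtension` — the Conte–Murre named fact `hodgeTwoTwo_algebraic_quarticQuinticFourfold`, DISCHARGED;
# and the crux `HypersurfaceHodgeFour` (stmt-HodgeConjecture-2997) reduced to degrees `≥ 6`

The Literature named fact `hodgeTwoTwo_algebraic_quarticQuinticFourfold` (file
`HodgeTheory/QuarticQuinticFourfoldHodgeClassesAlgebraic`; Conte–Murre 1978: every rational `(2,2)`-class on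
a smooth quartic or quintic fourfold `V(4), V(5) ⊂ ℙ⁵` is algebraic) is the degree-`4`/`5`, codimension-`2`
instance of the landed `hypersurfaceHodgeFourLowDegree_proof` (HC for smooth hypersurface fourfolds of
degree `≤ 5`: Fulton's degree formula `Fulton1998_degreeFormula_complexOrientation_holds` + spanning of top
Hodge classes `topHodgeClasses_spanned_by_pullbacks_holds`, file `LimitExtensionHypersurfaceHodgeFourLowDegreeProof`),
exactly as its sibling `hodgeTwoTwo_algebraic_cubicFourfold_holds` (Zucker, file
`CurveNetMordellWeilCubicFourfoldNormalFormHolds`). Consequence for the crux `HypersurfaceHodgeFour`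
(HC for ALL smooth hypersurface fourfolds): it is equivalent to its degree-`≥ 6` part
(`hypersurfaceHodgeFour_iff_six_le`), the honest open residue named in the item's docstring
("Open for every degree `≥ 6`"). No definition, no named-fact hypothesis, no sorry.
-/

noncomputable section

-- every declaration of this problem lives in `Summit.HodgeConjecture.HodgeConjecture.…` (summit = sub-problem)
set_option linter.dupNamespace false

namespace Summit.HodgeConjecture.HodgeConjecture.Theorems

open Literature.AlgebraicGeometry Literature.AlgebraicGeometry.Motives Literature.AlgebraicGeometry.HodgeTheory
open Summit.HodgeConjecture.HodgeConjecture.Theses.LimitExtension (HypersurfaceHodgeFour HypersurfaceHodgeFourLowDegree)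

/-- **Conte–Murre 1978, discharged** — the named fact `hodgeTwoTwo_algebraic_quarticQuinticFourfold`: every
rational `(2,2)`-class on a smooth quartic or quintic fourfold `X ⊂ ℙ⁵` is algebraic. Instance `d ∈ {4, 5}`,
`p = 2` of the cycle clause of `hypersurfaceHodgeFourLowDegree_proof`.
[cite: ConteMurre1978, Theorem (uniruled fourfolds) and its application to quartic and quintic fourfolds]
[cite: MurreTorino1994, Ch. V §5.3.1] -/
theorem hodgeTwoTwo_algebraic_quarticQuinticFourfold_holds : hodgeTwoTwo_algebraic_quarticQuinticFourfold :=
  fun _ _ hm hX c hc hpp ↦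
    (hypersurfaceHodgeFourLowDegree_proof (by rcases hm with rfl | rfl <;> norm_num) hX).2 2 c hc hpp

/-- **The crux `HypersurfaceHodgeFour` (stmt-HodgeConjecture-2997) is its degree-`≥ 6` part**: HC for all
smooth hypersurface fourfolds holds iff it holds in every degree `d ≥ 6`, the degrees `d ≤ 5` being the
theorem `hypersurfaceHodgeFourLowDegree_proof` (quadrics and `ℙ⁴`-like cases, Zucker's cubic, Conte–Murre's
quartic and quintic). [cite: ConteMurre1978, Theorem] [cite: Zucker1977, (3.2) Theorem] -/
theorem hypersurfaceHodgeFour_iff_six_le :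
    HypersurfaceHodgeFour ↔
      ∀ ⦃d : ℕ⦄ ⦃X : SchemeOver ℂ⦄, 6 ≤ d → IsSmoothHypersurface 4 d X → HodgeConjectureFor 4 X := by
  refine ⟨fun h d X _ hX ↦ h hX, fun h d X hX ↦ ?_⟩
  rcases Nat.lt_or_ge d 6 with hd | hd
  · exact hypersurfaceHodgeFourLowDegree_proof (by omega) hX
  · exact h hd hX

/-- **`HypersurfaceHodgeFour` BY NAME from its degree-`≥ 6` part** (the form a prover of the crux uses).
[cite: ConteMurre1978, Theorem] -/
theorem hypersurfaceHodgeFour_of_six_le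
    (h : ∀ ⦃d : ℕ⦄ ⦃X : SchemeOver ℂ⦄, 6 ≤ d → IsSmoothHypersurface 4 d X → HodgeConjectureFor 4 X) :
    HypersurfaceHodgeFour :=
  hypersurfaceHodgeFour_iff_six_le.2 h

end Summit.HodgeConjecture.HodgeConjecture.Theorems

end
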